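import Summits.PneNP.PneNP.Theorems.PhaseTwinsMacroscopicTwinsAboveConnectorExpect

/-!
# Route PhaseTwins, crux `MacroscopicTwinsAbove` (stmt-PneNP-2720), line `literal-gadgets-cfi-apparatus`:
# stub `stub_connector` — the copy-explicit connector sandwich (Sly's Lemma 2.2 for the literal-gadget wiring)

For ANY gadget with `(GpropA)` at `n` and `(GpropB)` with error `δ ≤ 1`, any system `E`, occurrence colouring `loc`
injective on the occurrences of each variable, and right-hand side `b`, the two conclusions `LGCutEstimate` hold for every
phase vector `Y`:

* `(phaseProbs)` `n^{-2nv} · Z(lgBase) ≤ Z_base(Y)` — `phaseProbs_lgBase` (part 1);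
* `(cutProb)` `(1-δ)^{2nv} · lgW b Y · Z_base(Y) ≤ Z_{𝔊(E,b)}(Y) ≤ (1+δ)^{2nv} · lgW b Y · Z_base(Y)` — decompose
  `Z_{𝔊(E,b)}(Y)` along the port patterns of the copies (`hardcoreZOn_lgGraph_phase_eq_sum`, part 2), compare each
  copy's restricted partition function with the product measure TERMWISE by `(GpropB)` (one factor `1 ± δ` per copy, so
  `(1 ± δ)^{2nv}` for EVERY number of variables — the density-scale form), and evaluate the product-measure expectation
  of the pattern weight (`expect_lgWt`, part 3): `lgW b Y · (1+λ)^{10mK}`, i.e. `lgW b Y · Z_base(Y)/Π_g Z_G(Y_g)`.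

This is the registered stub `stub_connector` of the skeleton `Lines/literal-gadgets-cfi-apparatus.lean`, with its exact
signature (the hypotheses `0 ≤ δ`, `0 < n` and the disjointness of the two port ranges are part of the registered signature
but are not needed). [folklore]
-/

noncomputable section

open scoped Classical BigOperators

namespace Summit.PneNP.PneNP.Cruxes.MacroscopicTwinsAbove.LiteralGadgetsCfiApparatus

open Finset
open Literature.Computability.Complexity (hardcoreZOn slyPhase portPattern portLaw portLaw_nonneg SlyPropA SlyPropB
  hardcoreZOn_nonneg le_and_le_of_abs_sub_le)
open Summit.PneNP.PneNP.Cruxes.PolyDepthTwinsAbove.ParityWiredPorts (occP occM)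

-- `Summit.PneNP.PneNP.…` (summit = sub-problem name) trips the duplicate-namespace linter on every declaration.
set_option linter.dupNamespace false

variable {nv m v P κ₁ D K : ℕ}

/-- **Termwise comparison over the copies** supplied by `(GpropB)`: for every family of port patterns,
`(1-δ)^{2nv} Π_g Q^{Y_g}(P_g) Z_G(Y_g) ≤ Π_g Z_G(Y_g, σ_V = P_g) ≤ (1+δ)^{2nv} Π_g Q^{Y_g}(P_g) Z_G(Y_g)`. -/
theorem prod_patterns_bounds (W : LWiring v P κ₁ D K) {lam : ℝ} (hlam : 0 ≤ lam) {qp qm δ : ℝ} (hqm : 0 < qm)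
    (hlt : qm < qp) (hqp : qp < 1) (hδ1 : δ ≤ 1) (hB : SlyPropB W.G lam W.Wp W.Wm W.Vp W.Vm qp qm δ)
    (Y : Fin nv × ZMod 2 → Bool) (Pt : Fin nv × ZMod 2 → Finset (Fin P) × Finset (Fin P)) :
    (1 - δ) ^ (2 * nv) * ∏ g, (portLaw (if Y g then qp else qm) (if Y g then qm else qp) P (Pt g) *
        hardcoreZOn W.G lam (fun S => slyPhase W.Wp W.Wm S = Y g)) ≤
      ∏ g, hardcoreZOn W.G lam (fun S => slyPhase W.Wp W.Wm S = Y g ∧ portPattern W.Vp W.Vm S = Pt g) ∧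
    ∏ g, hardcoreZOn W.G lam (fun S => slyPhase W.Wp W.Wm S = Y g ∧ portPattern W.Vp W.Vm S = Pt g) ≤
      (1 + δ) ^ (2 * nv) * ∏ g, (portLaw (if Y g then qp else qm) (if Y g then qm else qp) P (Pt g) *
        hardcoreZOn W.G lam (fun S => slyPhase W.Wp W.Wm S = Y g)) := by
  have hcard : Fintype.card (Fin nv × ZMod 2) = 2 * nv := by
    simp only [Fintype.card_prod, Fintype.card_fin, ZMod.card]; ring
  have hterm : ∀ g : Fin nv × ZMod 2,
      (1 - δ) * (portLaw (if Y g then qp else qm) (if Y g then qm else qp) P (Pt g) *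
          hardcoreZOn W.G lam (fun S => slyPhase W.Wp W.Wm S = Y g)) ≤
        hardcoreZOn W.G lam (fun S => slyPhase W.Wp W.Wm S = Y g ∧ portPattern W.Vp W.Vm S = Pt g) ∧
      hardcoreZOn W.G lam (fun S => slyPhase W.Wp W.Wm S = Y g ∧ portPattern W.Vp W.Vm S = Pt g) ≤
        (1 + δ) * (portLaw (if Y g then qp else qm) (if Y g then qm else qp) P (Pt g) *
          hardcoreZOn W.G lam (fun S => slyPhase W.Wp W.Wm S = Y g)) :=
    fun g => le_and_le_of_abs_sub_le (hB (Y g) (Pt g))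
  have hQ : ∀ g : Fin nv × ZMod 2, 0 ≤ portLaw (if Y g then qp else qm) (if Y g then qm else qp) P (Pt g) := by
    intro g
    cases Y g
    · exact portLaw_nonneg hqm.le (hlt.le.trans hqp.le) (hqm.le.trans hlt.le) hqp.le P (Pt g)
    · exact portLaw_nonneg (hqm.le.trans hlt.le) hqp.le hqm.le (hlt.le.trans hqp.le) P (Pt g)
  have hZ : ∀ g : Fin nv × ZMod 2, 0 ≤ hardcoreZOn W.G lam (fun S => slyPhase W.Wp W.Wm S = Y g) :=
    fun g => hardcoreZOn_nonneg W.G hlam _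
  constructor
  · rw [show ((1 : ℝ) - δ) ^ (2 * nv) = ∏ _g : Fin nv × ZMod 2, (1 - δ) by rw [prod_const, card_univ, hcard],
      ← prod_mul_distrib]
    refine prod_le_prod (fun g _ => mul_nonneg (by linarith) (mul_nonneg (hQ g) (hZ g))) fun g _ => (hterm g).1
  · rw [show ((1 : ℝ) + δ) ^ (2 * nv) = ∏ _g : Fin nv × ZMod 2, (1 + δ) by rw [prod_const, card_univ, hcard],
      ← prod_mul_distrib]
    exact prod_le_prod (fun g _ => hardcoreZOn_nonneg W.G hlam _) fun g _ => (hterm g).2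

/-- **S5 — the copy-explicit connector sandwich** (stub `stub_connector` of the line `literal-gadgets-cfi-apparatus`;
Sly's Lemma 2.2 for the literal-gadget wiring): for ANY gadget with `(GpropA)` at `n` and `(GpropB)` with error
`δ ≤ 1`, any system, right-hand side and occurrence colouring injective on the occurrences of each variable,
`LGCutEstimate` holds. (`0 ≤ δ`, `0 < n` and the disjointness of the port ranges are not used.) -/
theorem stub_connector (E : Fin m → Fin 3 → Fin nv) (loc : Fin m × Fin 3 → Fin D)
    (hloc : ∀ p p' : Fin m × Fin 3, E p.1 p.2 = E p'.1 p'.2 → loc p = loc p' → p = p')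
    (W : LWiring v P κ₁ D K) {lam qp qm δ : ℝ} (hlam : 0 ≤ lam) (hqm : 0 < qm) (hlt : qm < qp)
    (hqp : qp < 1) (hδ0 : 0 ≤ δ) (hδ1 : δ ≤ 1) {n : ℕ} (hn : 0 < n)
    (hVV : Disjoint (Set.range W.Vp) (Set.range W.Vm))
    (hA : SlyPropA W.G lam W.Wp W.Wm n) (hB : SlyPropB W.G lam W.Wp W.Wm W.Vp W.Vm qp qm δ)
    (b : Fin m → ZMod 2) : LGCutEstimate E loc W lam qp qm δ n b := by
  have _ := hδ0
  have _ := hn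
  have _ := hVV
  intro Y
  refine ⟨phaseProbs_lgBase W hlam hA Y, ?_⟩
  -- the expectation of the pattern weight, in the `if`-form of `(GpropB)`
  have hexp := expect_lgWt (K := K) E loc hloc W b hlam qp qm Y
  simp only [occP, occM] at hexp
  -- `Σ_P (Π_g Q(P_g) Z_G(Y_g)) · lgWt(P) = lgW b Y · Z_base(Y)`
  have hsum : ∑ Pt : Fin nv × ZMod 2 → Finset (Fin P) × Finset (Fin P),
      (∏ g, (portLaw (if Y g then qp else qm) (if Y g then qm else qp) P (Pt g) *
          hardcoreZOn W.G lam (fun S => slyPhase W.Wp W.Wm S = Y g))) * lgWt E loc W b lam Pt =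
        lgW E lam qp qm κ₁ K b Y * hardcoreZOn (lgBase nv m W) lam (fun I => lgPhase W I = Y) := by
    rw [hardcoreZOn_lgBase_phase]
    simp_rw [prod_mul_distrib]
    have halg : ∀ Pt : Fin nv × ZMod 2 → Finset (Fin P) × Finset (Fin P),
        ((∏ g, portLaw (if Y g then qp else qm) (if Y g then qm else qp) P (Pt g)) *
              ∏ g, hardcoreZOn W.G lam (fun S => slyPhase W.Wp W.Wm S = Y g)) * lgWt E loc W b lam Pt =
          (∏ g, hardcoreZOn W.G lam (fun S => slyPhase W.Wp W.Wm S = Y g)) *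
            ((∏ g, portLaw (if Y g then qp else qm) (if Y g then qm else qp) P (Pt g)) * lgWt E loc W b lam Pt) :=
      fun Pt => by ring
    simp_rw [halg]
    rw [← Finset.mul_sum, hexp]
    ring
  have hW0 : ∀ Pt : Fin nv × ZMod 2 → Finset (Fin P) × Finset (Fin P), 0 ≤ lgWt E loc W b lam Pt :=
    fun Pt => lgWt_nonneg E loc W b hlam Pt
  rw [hardcoreZOn_lgGraph_phase_eq_sum E loc W b lam Y, ← hsum, Finset.mul_sum, Finset.mul_sum]
  constructor
  · refine Finset.sum_le_sum fun Pt _ => ?_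
    rw [← mul_assoc]
    exact mul_le_mul_of_nonneg_right (prod_patterns_bounds W hlam hqm hlt hqp hδ1 hB Y Pt).1 (hW0 Pt)
  · refine Finset.sum_le_sum fun Pt _ => ?_
    rw [← mul_assoc]
    exact mul_le_mul_of_nonneg_right (prod_patterns_bounds W hlam hqm hlt hqp hδ1 hB Y Pt).2 (hW0 Pt)

end Summit.PneNP.PneNP.Cruxes.MacroscopicTwinsAbove.LiteralGadgetsCfiApparatus
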